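import Mathlib.Topology.Algebra.OpenSubgroup
import Mathlib.Topology.Algebra.InfiniteSum.Defs
import Mathlib.Data.Nat.Prime.Defs
import Mathlib.Data.PNat.Basic
import HarnessLib

/-!
# Frobenioids I, §2: topologically finitely generated profinite abelian groups, pro-`l` portions, `ζ`-th powers (Definition 2.8)

Mochizuki, *The geometry of Frobenioids I*, Kyushu J. Math. **62** (2008), §2, Definition 2.8,
kurims pp. 52–53 [cite: MochizukiFrdI2008, Def. 2.8 p.52].  This file holds the group-theoretic
content of Def. 2.8, which involves no Frobenioid: (i) the predicate "admits a profinite topology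
for which it is a topologically finitely generated profinite [abelian] group" (applied to the
`O^×(A)` in `BaseFrobeniusSections.lean` to define *unit-profinite type*); (ii) for a topologically
finitely generated profinite abelian group `M`, the *pro-`l` portion* `M[l]` and the decomposition
`M = ∏_l M[l]`; (iii) for `ζ : Primes → ℕ_{≥1}`, the map "raising to the `ζ`-th power" (`ζ(l)`-th
power on `M[l]`), functions `ζ` *of co-prime type*, and "[if `ζ` is of co-prime type, then the map
given by raising to the `ζ`-th power will always be bijective]".

**Rendering.** `M[l]` is defined as the set of `x` whose image in every open (normal, as `M` is
abelian) subgroup quotient has `l`-power order (`x^{l^n} ∈ U`); the product decomposition and the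
`ζ`-th power map are characterised by predicates (`IsZetaPowerMap`) with their existence/uniqueness
and the bijectivity claim recorded as statements — their proofs are standard profinite group theory
not yet in Mathlib (no `sorry`, no axiom).  Groups are written multiplicatively ("assume that the
group law of `M` is written multiplicatively", (iii)).
-/

namespace Literature.AlgebraicGeometry.Frobenioids

open Topology

universe u

section Profinite

variable (M : Type u) [Group M]

/-- A given topology makes `M` a *topologically finitely generated profinite* group:
a compact, Hausdorff, totally disconnected topological group with a finite subset generating a dense
subgroup (Def. 2.8 (i), (ii)). [cite: MochizukiFrdI2008, Def. 2.8(i) p.52] -/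
structure IsTfgProfinite [TopologicalSpace M] : Prop where
  /-- topological group -/
  isTopologicalGroup : IsTopologicalGroup M
  /-- compact -/
  compactSpace : CompactSpace M
  /-- Hausdorff -/
  t2Space : T2Space M
  /-- totally disconnected -/
  totallyDisconnectedSpace : TotallyDisconnectedSpace M
  /-- topologically finitely generated: some finite subset generates a dense subgroup -/
  exists_finset_dense : ∃ S : Finset M, Dense (Subgroup.closure (S : Set M) : Set M)

/-- `M` "admits a profinite topology such that `M`, equipped with this topology, is a topologically
finitely generated profinite group" (Def. 2.8 (i)). [cite: MochizukiFrdI2008, Def. 2.8(i) p.52] -/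
def AdmitsTfgProfiniteTopology : Prop := ∃ t : TopologicalSpace M, @IsTfgProfinite M _ t

/-- Def. 2.8 (i), bracket "[uniquely determined]" (statement): two topologies on `M` both making it
a topologically finitely generated profinite group coincide. [cite: MochizukiFrdI2008, Def. 2.8(i) p.52] -/
def TfgProfiniteTopologyUnique : Prop :=
  ∀ t₁ t₂ : TopologicalSpace M, @IsTfgProfinite M _ t₁ → @IsTfgProfinite M _ t₂ → t₁ = t₂

/-- Def. 2.8 (i), "[uniquely determined]", in the printed scope: for an ABELIAN group (the `O^×(A)` of
a Frobenioid, "topologically finitely generated profinite [abelian] group") two such topologies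
coincide.  (For arbitrary groups `TfgProfiniteTopologyUnique` is the Nikolov–Segal theorem; the text
only uses the abelian case — audit L1-t12.) [cite: MochizukiFrdI2008, Def. 2.8(i) p.52] -/
abbrev TfgProfiniteAbelianTopologyUnique (M : Type u) [CommGroup M] : Prop := TfgProfiniteTopologyUnique M

end Profinite

section ProL

variable (M : Type u) [CommGroup M] [TopologicalSpace M]

/-- The *pro-`l` portion* `M[l] ⊆ M` of a profinite abelian group (Def. 2.8 (ii)): the elements
whose image in every discrete quotient `M/U` (`U` an open subgroup) has `l`-power order.
[cite: MochizukiFrdI2008, Def. 2.8(ii) p.52] -/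
def proL (l : Nat.Primes) : Subgroup M where
  carrier := {x | ∀ U : OpenSubgroup M, ∃ n : ℕ, x ^ ((l : ℕ) ^ n) ∈ U}
  one_mem' U := ⟨0, by rw [one_pow]; exact U.one_mem⟩
  mul_mem' {x y} hx hy U := by
    obtain ⟨n, hn⟩ := hx U
    obtain ⟨m, hm⟩ := hy U
    refine ⟨n + m, ?_⟩
    rw [mul_pow]
    refine U.mul_mem ?_ ?_
    · rw [pow_add, pow_mul]
      exact U.pow_mem hn _
    · rw [pow_add, mul_comm, pow_mul]
      exact U.pow_mem hm _
  inv_mem' {x} hx U := by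
    obtain ⟨n, hn⟩ := hx U
    exact ⟨n, by rw [inv_pow]; exact U.inv_mem hn⟩

/-- Def. 2.8 (ii) (statement): "`M` decomposes as a direct product of pro-`l` groups `M[l]`" — every
element is, uniquely, a convergent product of elements of the various `M[l]`.
[cite: MochizukiFrdI2008, Def. 2.8(ii) p.52] -/
def ProLDecomposition : Prop :=
  IsTfgProfinite M → ∀ x : M, ∃! f : Nat.Primes → M,
    (∀ l, f l ∈ proL M l) ∧ Multipliable f ∧ ∏' l, f l = x

/-- "The map given by raising to the `ζ`-th power on `M`" for `ζ : Primes → ℕ_{≥1}` (Def. 2.8 (iii)):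
characterised as the continuous endomorphism that is the `ζ(l)`-th power map on each `M[l]`.
[cite: MochizukiFrdI2008, Def. 2.8(iii) p.52] -/
structure IsZetaPowerMap (ζ : Nat.Primes → ℕ+) (f : M → M) : Prop where
  /-- continuous -/
  continuous : Continuous f
  /-- a homomorphism -/
  map_mul : ∀ x y : M, f (x * y) = f x * f y
  /-- the `ζ(l)`-th power on `M[l]` -/
  eq_pow : ∀ (l : Nat.Primes), ∀ x ∈ proL M l, f x = x ^ ((ζ l : ℕ+) : ℕ)

/-- Def. 2.8 (iii) (statement): for a topologically finitely generated profinite abelian `M` the map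
"raising to the `ζ`-th power" exists and is unique. [cite: MochizukiFrdI2008, Def. 2.8(iii) p.52] -/
def ZetaPowerMapExistsUnique (ζ : Nat.Primes → ℕ+) : Prop :=
  IsTfgProfinite M → ∃! f : M → M, IsZetaPowerMap M ζ f

variable {M}

/-- `ζ : Primes → ℕ_{≥1}` is *of co-prime type* if `ζ(l)` is prime to `l` for every `l`
(Def. 2.8 (iii)). [cite: MochizukiFrdI2008, Def. 2.8(iii) p.52] -/
def IsOfCoprimeType (ζ : Nat.Primes → ℕ+) : Prop := ∀ l : Nat.Primes, Nat.Coprime (ζ l : ℕ) (l : ℕ)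

variable (M)

/-- Def. 2.8 (iii), bracket (statement): "[Thus, if `ζ` is of co-prime type, then the map given by
raising to the `ζ`-th power will always be bijective.]" [cite: MochizukiFrdI2008, Def. 2.8(iii) p.53] -/
def ZetaPowerMapBijectiveOfCoprime (ζ : Nat.Primes → ℕ+) : Prop :=
  IsTfgProfinite M → IsOfCoprimeType ζ → ∀ f : M → M, IsZetaPowerMap M ζ f → Function.Bijective f

end ProL

end Literature.AlgebraicGeometry.Frobenioids
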